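import Literature.MathematicalPhysics.QuantumLattice.HubbardPairDensityCouplingCeiling
import Literature.MathematicalPhysics.QuantumLattice.PairCorrelationsProofs
import Literature.MathematicalPhysics.QuantumLattice.LatticeToriLROProofs
import HarnessLib

/-!
# A-priori ceiling on the `d`-wave pair-field LRO amplitude of doped Hubbard ground states, in the format of `hubbard.S01`

Family `hubbard` / topic `MathematicalPhysics/QuantumLattice`; proof-only. At hole doping
`δ ∈ (0, 1/2)` and EVEN side `L` — the data of the summit statement
`Literature.Hubbard.DWaveSuperconductivityHubbard` (`hubbard.S01`) — the closed-form ceiling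
`pairDensity_le_mul_coupling_mul_log_coupling` of `HubbardPairDensityCouplingCeiling.lean` applies with
`d₀ = (δ/4)²`: the Fermi-level bookkeeping `fermiLevel_conditions_doping` discharges its level-count
hypotheses for `L ≥ ⌈160/δ⌉ + 17` (particle–hole symmetry of the band at even `L`,
`TorusBandParticleHole.lean`). Results:

* `fermiLevel_conditions_doping` — the LITERATURE HOME of the Summits-side lemma
  `Summit.…Theorems.BirGroundStateAverageLRO.Negative.fermiLevel_conditions`
  (`Summits/HubbardSuperconductivity/…/Negative/PairingCostLog.lean`, same statement and proof), which a
  Literature file cannot import; the Summits copy predates this file and is kept by the append-only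
  rule.
* `hubbardTorus_groundState_dWavePairDensity_le_doped` — `δ ∈ (0,1/2)`, `U > 0`, `c > 0`, even
  `L ≥ ⌈12800/c⌉ + ⌈160/δ⌉ + 17`, `ψ` a normalised ground state of `hubbardTorus 2 L 1 U` in the
  sector `(2⌊(1-δ)L²/2⌋, S^z = 0)` with `c·L⁴ ≤ Re ⟨ψ, Δ_d†Δ_d ψ⟩` ⇒
  **`c ≤ (16384/δ)·U·log(4 + 32/√U)`**; `re_expect_pairField_dWave_lt_of_groundState_doped` — the
  a-priori form.
* `liminf_dWavePairFieldCorr_le_of_groundStates` — IN THE SUMMIT'S FORMAT: for `U > 0`,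
  `δ ∈ (0,1/2)` and `(N, ψ)` satisfying the hypothesis clause of `hubbard.S01` verbatim (at every even
  `L`: `N L = 2⌊(1-δ)L²/2⌋`, `ψ L` normalised, a ground state of `hubbardTorus 2 L 1 U` in the sector
  `(N L, 0)`), the sequence whose `liminf` the summit asks to be positive,
  `k ↦ |Λ_{2k}|⁻² Σ_{x,y ∈ Λ_{2k}} torusPullback (pairFieldCorr g_d ψ) (2k) x y`
  (`Λ_{2k} = halfOpenBox 2 (2k)`), has **`liminf ≤ (16384/δ)·U·log(4 + 32/√U)`**.

Reading (regime map for every route to the summit). Whatever `(U, δ)` witnesses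
`HubbardSuperconductivity`, the order-parameter density it exhibits is at most
`(16384/δ)·U·log(4 + 32/√U) → 0` (`U → 0⁺`, BCS rate `U log(1/U)`); the expected truth is
`e^{-O(1/U²)}`-small (`Literature/Barriers/HubbardSuperconductivity/PerturbativeInvisibilityOfPairing.lean`).
No printed counterpart of this `T = 0` ceiling is known to the tree (the catalogued no-go results —
Koma–Tasaki 1992, Su–Suzuki 1998 — are `T > 0` or assume a gap); it is an elementary consequence of
the variational principle (first-order kinetic budget `U·L²`) and the pairing-cost inequality of
`FreeFermiGasPairingCostLog.lean`.

Sources: Bardeen–Cooper–Schrieffer, Phys. Rev. 108 (1957) 1175, §II–III; D. J. Scalapino, Phys.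
Rep. 250 (1995) 329, §2 eq. (2.4) (the LRO functional); E. H. Lieb, PRL 62 (1989) 1201
(particle–hole symmetry at even `L`); Friedli–Velenik (2017) §3.7.2 Definition 3.27
(`HasLongRangeOrder`). Folklore finite-dimensional statements; no named facts, no definitions.
Tree search: `pairDensity_le_mul_coupling_mul_log_coupling`, `torusLROSeq_pairFieldCorr_succ`,
`sub_le_two_mul_card_filter_torusBand_le_neg`, `card_filter_torusBand_lt_neg_four_add_le`,
`posSemidef_conjTranspose_mul_self`, `Filter.liminf_le_of_frequently_le`,
`Filter.isBoundedUnder_of_eventually_ge`; Mathlib: `Nat.sub_one_lt_floor`, `Nat.le_ceil`.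
-/

noncomputable section

namespace Literature.MathematicalPhysics.QuantumLattice

open Matrix Finset Filter Literature.Probability.LatticeModels
open scoped ComplexOrder ComplexConjugate

variable {L : ℕ} [NeZero L]

/-! ### Hole doping `δ`, even side: the summit's data -/

/-- **Fermi-level bookkeeping at doping `δ`, even `L`** (Literature home of the Summits-side
`BirGroundStateAverageLRO.Negative.fermiLevel_conditions`). For `δ ∈ (0,1/2)`, even
`L ≥ ⌈160/δ⌉ + 17`, `d₀ = (δ/4)²` and `n = ⌊(1-δ)L²/2⌋`: (i) `n ≤ #{k : ε_L(k) ≤ -d₀}` (particle–hole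
symmetry leaves at least `(L² - (δ/4)L² - 2L)/2 ≥ n` levels below `-d₀`,
`sub_le_two_mul_card_filter_torusBand_le_neg`), (ii) `#{k : ε_L(k) < -4 + d₀} < n` (at most
`(δ/4)L² + 2L` levels near the band bottom, `card_filter_torusBand_lt_neg_four_add_le`), (iii)
`√d₀·L ≥ 40`. Lieb, PRL 62 (1989) 1201 (bipartite particle–hole symmetry). [folklore] -/
theorem fermiLevel_conditions_doping {δ : ℝ} (hδ : δ ∈ Set.Ioo (0:ℝ) (1/2)) (L : ℕ) [NeZero L]
    (hL : ⌈160 / δ⌉₊ + 17 ≤ L) (hev : Even L) :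
    ⌊(1 - δ) * (L : ℝ) ^ 2 / 2⌋₊ ≤
        (Finset.univ.filter fun k : TorusSite 2 L => torusBand L k ≤ -((δ / 4) ^ 2)).card ∧
      (Finset.univ.filter fun k : TorusSite 2 L => torusBand L k < (-4 : ℝ) + (δ / 4) ^ 2).card <
        ⌊(1 - δ) * (L : ℝ) ^ 2 / 2⌋₊ ∧
      40 ≤ Real.sqrt ((δ / 4) ^ 2) * L := by
  obtain ⟨hδ0, hδ1⟩ := hδ
  have hsq : Real.sqrt ((δ / 4) ^ 2) = δ / 4 := Real.sqrt_sq (by positivity)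
  have hL17 : (17 : ℝ) ≤ L := by exact_mod_cast (show 17 ≤ L by omega)
  have hLδ : 160 / δ ≤ (L : ℝ) := by
    have hceil : 160 / δ ≤ (⌈160 / δ⌉₊ : ℝ) := Nat.le_ceil _
    have : (⌈160 / δ⌉₊ : ℝ) + 17 ≤ L := by exact_mod_cast hL
    linarith
  have hδL : 160 ≤ δ * L := by rwa [div_le_iff₀' hδ0] at hLδ
  have hL0 : (0 : ℝ) ≤ L := Nat.cast_nonneg _
  set y : ℝ := (1 - δ) * (L : ℝ) ^ 2 / 2 with hy
  have hy0 : 0 ≤ y := by rw [hy]; nlinarith [sq_nonneg (L : ℝ)]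
  have hfloor_le : (⌊y⌋₊ : ℝ) ≤ y := Nat.floor_le hy0
  have hlt_floor : y - 1 < (⌊y⌋₊ : ℝ) := Nat.sub_one_lt_floor y
  refine ⟨?_, ?_, ?_⟩
  · have h := sub_le_two_mul_card_filter_torusBand_le_neg (L := L) hev
      (t := (δ / 4) ^ 2) (by positivity)
    rw [hsq] at h
    have hreal : (⌊y⌋₊ : ℝ) ≤
        ((Finset.univ.filter fun k : TorusSite 2 L => torusBand L k ≤ -((δ / 4) ^ 2)).card : ℝ) := by
      have : 2 * y ≤ (L : ℝ) ^ 2 - δ / 4 * (L : ℝ) ^ 2 - 2 * L := by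
        rw [hy]
        nlinarith [mul_le_mul_of_nonneg_right hδL hL0]
      linarith
    exact_mod_cast hreal
  · have h := card_filter_torusBand_lt_neg_four_add_le (L := L) ((δ / 4) ^ 2)
    rw [hsq] at h
    have hreal : ((Finset.univ.filter fun k : TorusSite 2 L =>
        torusBand L k < (-4 : ℝ) + (δ / 4) ^ 2).card : ℝ) < (⌊y⌋₊ : ℝ) := by
      have hcoef : (1 : ℝ) / 8 ≤ 1 / 2 - 3 * δ / 4 := by linarith
      have : δ / 4 * (L : ℝ) ^ 2 + 2 * L ≤ y - 1 := by
        rw [hy]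
        nlinarith [mul_le_mul_of_nonneg_right hcoef (sq_nonneg (L : ℝ))]
      linarith
    exact_mod_cast hreal
  · rw [hsq]
    linarith

/-- **Doped closed form.** For `δ ∈ (0,1/2)`, `U > 0`, `c > 0`, EVEN `L ≥ ⌈12800/c⌉ + ⌈160/δ⌉ + 17`
and a normalised ground state `ψ` of `hubbardTorus 2 L 1 U` in the sector
`(2⌊(1-δ)L²/2⌋, S^z = 0)` with `c·L⁴ ≤ Re ⟨ψ, Δ_d†Δ_d ψ⟩`:
`c ≤ (16384/δ)·U·log(4 + 32/√U)` — the ground-state `d`-wave pair density of the doped repulsive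
Hubbard torus is `O_δ(U log(1/U))`, uniformly in the (large, even) side. [folklore] -/
theorem hubbardTorus_groundState_dWavePairDensity_le_doped {δ U c : ℝ}
    (hδ : δ ∈ Set.Ioo (0:ℝ) (1/2)) (hU : 0 < U) (hc : 0 < c)
    (hL : ⌈12800 / c⌉₊ + ⌈160 / δ⌉₊ + 17 ≤ L) (hev : Even L)
    {ψ : Fock (Orb (FermionTorus 2 L))}
    (hψ : IsGroundStateInSector (hubbardTorus 2 L 1 U) (2 * ⌊(1 - δ) * (L : ℝ) ^ 2 / 2⌋₊) 0 ψ)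
    (h1 : star ψ ⬝ᵥ ψ = 1)
    (hY : c * (L : ℝ) ^ 4 ≤
      (star ψ ⬝ᵥ (((pairField dWaveFormFactor L)ᴴ * pairField dWaveFormFactor L) *ᵥ ψ)).re) :
    c ≤ 16384 / δ * U * Real.log (4 + 32 / Real.sqrt U) := by
  obtain ⟨hC1, hC2, hLd⟩ := fermiLevel_conditions_doping hδ L (by omega) hev
  have hL3 : 3 ≤ L := by omega
  have hLc : 12800 ≤ c * (L : ℝ) ^ 2 := by
    have hceil : 12800 / c ≤ (⌈12800 / c⌉₊ : ℝ) := Nat.le_ceil _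
    have hL' : (⌈12800 / c⌉₊ : ℝ) ≤ (L : ℝ) := by exact_mod_cast (show ⌈12800 / c⌉₊ ≤ L by omega)
    have hle' : 12800 / c ≤ (L : ℝ) := hceil.trans hL'
    rw [div_le_iff₀' hc] at hle'
    have hL1 : (1 : ℝ) ≤ L := by exact_mod_cast (show 1 ≤ L by omega)
    nlinarith
  have hd : (0 : ℝ) < (δ / 4) ^ 2 := by have := hδ.1; positivity
  have h := pairDensity_le_mul_coupling_mul_log_coupling hc hU hd hL3 hLc hLd hC1 hC2 hψ h1 hY
  have hsq : Real.sqrt ((δ / 4) ^ 2) = δ / 4 := Real.sqrt_sq (by linarith [hδ.1])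
  rw [hsq] at h
  have e : 4096 / (δ / 4) = 16384 / δ := by
    rw [div_div_eq_mul_div]; ring
  rwa [e] at h

/-- **Doped a-priori form.** For `δ ∈ (0,1/2)`, `U > 0`, `c > 0` with
`(16384/δ)·U·log(4 + 32/√U) < c`, and EVEN `L ≥ ⌈12800/c⌉ + ⌈160/δ⌉ + 17`, every normalised ground
state of `hubbardTorus 2 L 1 U` in the sector `(2⌊(1-δ)L²/2⌋, S^z = 0)` has
`Re ⟨ψ, Δ_d†Δ_d ψ⟩ < c·L⁴`. [folklore] -/
theorem re_expect_pairField_dWave_lt_of_groundState_doped {δ U c : ℝ}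
    (hδ : δ ∈ Set.Ioo (0:ℝ) (1/2)) (hU : 0 < U) (hc : 0 < c)
    (hcU : 16384 / δ * U * Real.log (4 + 32 / Real.sqrt U) < c)
    (hL : ⌈12800 / c⌉₊ + ⌈160 / δ⌉₊ + 17 ≤ L) (hev : Even L)
    {ψ : Fock (Orb (FermionTorus 2 L))}
    (hψ : IsGroundStateInSector (hubbardTorus 2 L 1 U) (2 * ⌊(1 - δ) * (L : ℝ) ^ 2 / 2⌋₊) 0 ψ)
    (h1 : star ψ ⬝ᵥ ψ = 1) :
    (star ψ ⬝ᵥ (((pairField dWaveFormFactor L)ᴴ * pairField dWaveFormFactor L) *ᵥ ψ)).re <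
      c * (L : ℝ) ^ 4 := by
  by_contra h
  push Not at h
  have := hubbardTorus_groundState_dWavePairDensity_le_doped hδ hU hc hL hev hψ h1 h
  linarith

/-! ### The summit's format: `liminf` of the even-side LRO sequence -/

omit [NeZero L] in
/-- **A-priori ceiling on the LRO amplitude in the format of `hubbard.S01`.** Let `U > 0`,
`δ ∈ (0,1/2)`, and let `N`, `ψ` satisfy the hypothesis clause of the summit statement
`Literature.Hubbard.DWaveSuperconductivityHubbard`: at every even side `L`,
`N L = 2⌊(1-δ)L²/2⌋`, `ψ L` is normalised and is a ground state of `hubbardTorus 2 L 1 U` in the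
sector `(N L, S^z = 0)`. Then the sequence whose `liminf` the summit asks to be positive satisfies
`liminf_k |Λ_{2k}|⁻² Σ_{x,y ∈ Λ_{2k}} torusPullback (pairFieldCorr g_d ψ) (2k) x y ≤
(16384/δ)·U·log(4 + 32/√U)`, `Λ_{2k} = halfOpenBox 2 (2k)`: any witness `(U, δ)` of the summit
exhibits an order-parameter density of at most `O_δ(U log(1/U))`. (The `k`-th term equals
`(2k)⁻⁴ Re ⟨ψ_{2k}, Δ_d†Δ_d ψ_{2k}⟩` by `torusLROSeq_pairFieldCorr_succ`; it is `≥ 0`, so the real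
`liminf` is not at its junk value from below, and it is eventually `< c` for every `c` above the
ceiling by `re_expect_pairField_dWave_lt_of_groundState_doped`.) Scalapino, Phys. Rep. 250 (1995)
329, §2 eq. (2.4); Friedli–Velenik (2017) §3.7.2. [folklore] -/
theorem liminf_dWavePairFieldCorr_le_of_groundStates {U δ : ℝ} (hU : 0 < U)
    (hδ : δ ∈ Set.Ioo (0:ℝ) (1/2)) (N : ℕ → ℕ) (ψ : ∀ L, Fock (Orb (FermionTorus 2 L)))
    (hGS : ∀ L, Even L → N L = 2 * ⌊(1 - δ) * (L : ℝ) ^ 2 / 2⌋₊ ∧ star (ψ L) ⬝ᵥ ψ L = 1 ∧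
      IsGroundStateInSector (hubbardTorus 2 L 1 U) (N L) 0 (ψ L)) :
    liminf (fun k : ℕ => (∑ x ∈ halfOpenBox 2 (2 * k), ∑ y ∈ halfOpenBox 2 (2 * k),
        torusPullback (pairFieldCorr dWaveFormFactor ψ) (2 * k) x y) /
          ((#(halfOpenBox 2 (2 * k)) : ℝ)) ^ 2) atTop ≤
      16384 / δ * U * Real.log (4 + 32 / Real.sqrt U) := by
  set C : ℝ := 16384 / δ * U * Real.log (4 + 32 / Real.sqrt U) with hC
  set u : ℕ → ℝ := fun k => (∑ x ∈ halfOpenBox 2 (2 * k), ∑ y ∈ halfOpenBox 2 (2 * k),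
      torusPullback (pairFieldCorr dWaveFormFactor ψ) (2 * k) x y) /
        ((#(halfOpenBox 2 (2 * k)) : ℝ)) ^ 2 with hu
  change liminf u atTop ≤ C
  have hC0 : 0 < C := mul_mul_log_four_add_pos (by have := hδ.1; positivity) hU
  -- the `k`-th term for `k ≥ 1`, and its sign
  have hterm : ∀ k : ℕ, 1 ≤ k → ∃ n : ℕ, 2 * k = n + 1 ∧
      u k = (star (ψ (n + 1)) ⬝ᵥ (((pairField dWaveFormFactor (n + 1))ᴴ *
        pairField dWaveFormFactor (n + 1)) *ᵥ ψ (n + 1))).re / ((n + 1 : ℕ) : ℝ) ^ 4 := by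
    intro k hk
    refine ⟨2 * k - 1, by omega, ?_⟩
    have e : 2 * k = (2 * k - 1) + 1 := by omega
    simp only [hu]
    rw [e, torusLROSeq_pairFieldCorr_succ]
    rfl
  have hnonneg : ∀ k : ℕ, 1 ≤ k → 0 ≤ u k := by
    intro k hk
    obtain ⟨n, -, hn⟩ := hterm k hk
    rw [hn]
    refine div_nonneg ?_ (by positivity)
    exact (posSemidef_conjTranspose_mul_self (pairField dWaveFormFactor (n + 1))).re_dotProduct_nonneg
      (ψ (n + 1))
  have hbdd : IsBoundedUnder (· ≥ ·) atTop u :=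
    isBoundedUnder_of_eventually_ge (a := 0)
      (Filter.eventually_atTop.2 ⟨1, fun k hk => hnonneg k hk⟩)
  -- for every `c > C`, eventually `u k < c`
  have hev : ∀ c : ℝ, C < c → ∀ᶠ k in atTop, u k ≤ c := by
    intro c hc
    have hc0 : 0 < c := hC0.trans hc
    rw [Filter.eventually_atTop]
    refine ⟨⌈12800 / c⌉₊ + ⌈160 / δ⌉₊ + 18, fun k hk => ?_⟩
    obtain ⟨n, hn2, hn⟩ := hterm k (by omega)
    obtain ⟨hN, hnorm, hgs⟩ := hGS (n + 1) ⟨k, by omega⟩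
    rw [hN] at hgs
    haveI : NeZero (n + 1) := ⟨by omega⟩
    have hlt := re_expect_pairField_dWave_lt_of_groundState_doped (L := n + 1) hδ hU hc0 hc
      (by omega) ⟨k, by omega⟩ hgs hnorm
    rw [hn, div_le_iff₀ (by positivity)]
    exact hlt.le
  -- conclude
  by_contra hlt
  push Not at hlt
  have hmid : C < (C + liminf u atTop) / 2 := by linarith
  have h := liminf_le_of_frequently_le ((hev _ hmid).frequently) hbdd
  linarith

end Literature.MathematicalPhysics.QuantumLattice
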